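import Summits.Ventures.PercRepro.C041ZoneZDefs

/-!
# THEOREM Z — the reach lemmas (p6, gen 27; C-041.md §12 (k))

Setting of `C041ZoneZDefs`.  Generic facts on `reach` / `reachIn` (membership, closure, monotonicity, symmetry,
`reachIn ⊆ U`, the reach of a set closed under the adjacency is its reach inside that set), the symmetry of the
adjacencies, and the TWO TRANSFER PRINCIPLES of the involutions:

* AGREEMENT (`reach_eq_of_agree`): two states agreeing on every edge touching a set `X` that contains the reach of `S`
  have the same reach of `S` — a path from `S` only uses edges touching its own vertices; hence the region of each
  involution (`P`, `D ∪ P`, `C ∪ P`) is preserved by it (`P_dual_eq`, `P_flipOut_eq`, `D_flipOut_eq`, `Cmix_dual_eq`);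
* COMPLEMENT (`redAdj_dual_iff`, `blueAdj_dual_iff`, `redAdj_flipOut_iff`, `blueAdj_flipOut_iff`,
  `mixedAdj_dual_iff`): between two vertices outside `X` the image's red adjacency is the original blue adjacency and
  conversely; the mixed adjacency relative to `P` of `dual P σ` is the red adjacency of `σ` everywhere.

Also: a set closed under a symmetric adjacency cannot be entered from outside (`not_mem_of_adj_of_closed`), the
blue reach of a set is blue-closed, and `P ∩ D = ∅` under `Γ` (`disjoint_P_D`).
-/

namespace PercRepro

namespace ZoneZ

namespace ZoneData

variable {V E T₁ T₂ : Type*}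

/-! ## Generic reach facts -/

/-- A vertex of `S` is reached from `S`. -/
theorem mem_reach_of_mem {R : V → V → Prop} {S : Set V} {s : V} (hs : s ∈ S) : s ∈ reach R S :=
  ⟨s, hs, Relation.ReflTransGen.refl⟩

/-- The reach is closed under one more step. -/
theorem reach_tail {R : V → V → Prop} {S : Set V} {u v : V} (hu : u ∈ reach R S) (h : R u v) : v ∈ reach R S := by
  obtain ⟨s, hs, hsu⟩ := hu
  exact ⟨s, hs, hsu.tail h⟩

/-- The reach is closed under paths. -/
theorem reach_trans {R : V → V → Prop} {S : Set V} {u v : V} (hu : u ∈ reach R S)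
    (h : Relation.ReflTransGen R u v) : v ∈ reach R S := by
  obtain ⟨s, hs, hsu⟩ := hu
  exact ⟨s, hs, hsu.trans h⟩

/-- The reach of `S` lies in every set containing `S` and closed under the adjacency. -/
theorem reach_subset_of_closed {R : V → V → Prop} {S U : Set V} (hS : S ⊆ U)
    (hU : ∀ u v, u ∈ U → R u v → v ∈ U) : reach R S ⊆ U := by
  rintro v ⟨s, hs, h⟩
  induction h with
  | refl => exact hS hs
  | tail _ h ih => exact hU _ _ ih h

/-- The reach is monotone in the adjacency and in the source set. -/
theorem reach_mono {R R' : V → V → Prop} {S S' : Set V} (hR : ∀ u v, R u v → R' u v) (hS : S ⊆ S') :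
    reach R S ⊆ reach R' S' := by
  rintro v ⟨s, hs, h⟩
  refine ⟨s, hS hs, ?_⟩
  induction h with
  | refl => exact Relation.ReflTransGen.refl
  | tail _ h ih => exact ih.tail (hR _ _ h)

/-- The source set lies in its reach. -/
theorem subset_reach {R : V → V → Prop} {S : Set V} : S ⊆ reach R S := fun _ hs => mem_reach_of_mem hs

/-- The reflexive-transitive closure of a symmetric relation is symmetric. -/
theorem reflTransGen_symm {R : V → V → Prop} (hR : ∀ x y, R x y → R y x) {u v : V}
    (h : Relation.ReflTransGen R u v) : Relation.ReflTransGen R v u := by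
  induction h with
  | refl => exact Relation.ReflTransGen.refl
  | tail _ h ih => exact Relation.ReflTransGen.head (hR _ _ h) ih

/-- Along a symmetric adjacency, a vertex reached from `u` reaches `u`. -/
theorem mem_reach_singleton_symm {R : V → V → Prop} (hR : ∀ x y, R x y → R y x) {u v : V}
    (h : v ∈ reach R {u}) : u ∈ reach R {v} := by
  obtain ⟨s, hs, hsv⟩ := h
  rw [Set.mem_singleton_iff] at hs
  subst hs
  exact ⟨v, rfl, reflTransGen_symm hR hsv⟩

/-- Along a symmetric adjacency, a vertex reached from `S` reaches a vertex of `S`. -/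
theorem exists_mem_reach_of_mem_reach {R : V → V → Prop} (hR : ∀ x y, R x y → R y x) {S : Set V} {v : V}
    (h : v ∈ reach R S) : ∃ s ∈ S, s ∈ reach R {v} := by
  obtain ⟨s, hs, hsv⟩ := h
  exact ⟨s, hs, v, rfl, reflTransGen_symm hR hsv⟩

/-- The reach inside `U` lies in `U`. -/
theorem reachIn_subset {R : V → V → Prop} {U S : Set V} : reachIn R U S ⊆ U :=
  reach_subset_of_closed Set.inter_subset_right fun _ _ _ h => h.2.2

/-- The reach inside `U` lies in the reach. -/
theorem reachIn_subset_reach {R : V → V → Prop} {U S : Set V} : reachIn R U S ⊆ reach R S :=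
  reach_mono (fun _ _ h => h.1) Set.inter_subset_left

/-- The reach inside `U` is monotone in `U` and in the source set. -/
theorem reachIn_mono {R : V → V → Prop} {U U' S S' : Set V} (hU : U ⊆ U') (hS : S ⊆ S') :
    reachIn R U S ⊆ reachIn R U' S' :=
  reach_mono (fun _ _ h => ⟨h.1, hU h.2.1, hU h.2.2⟩) (Set.inter_subset_inter hS hU)

/-- The reach of a set `S ⊆ U` closed under `R` is its reach inside `U`. -/
theorem reach_subset_reachIn_of_closed {R : V → V → Prop} {U S : Set V} (hS : S ⊆ U)
    (hU : ∀ u v, u ∈ U → R u v → v ∈ U) : reach R S ⊆ reachIn R U S := by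
  rintro v ⟨s, hs, h⟩
  induction h with
  | refl => exact mem_reach_of_mem ⟨hs, hS hs⟩
  | tail _ h ih => exact reach_tail ih ⟨h, reachIn_subset ih, hU _ _ (reachIn_subset ih) h⟩

/-- A set closed under a symmetric adjacency cannot be entered from outside. -/
theorem not_mem_of_adj_of_closed {R : V → V → Prop} (hR : ∀ x y, R x y → R y x) {U : Set V}
    (hU : ∀ u v, u ∈ U → R u v → v ∈ U) {u v : V} (hu : u ∉ U) (h : R u v) : v ∉ U :=
  fun hv => hu (hU v u hv (hR u v h))

variable (Z : ZoneData V E T₁ T₂)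

/-! ## Adjacencies -/

/-- An edge joining `u` and `v` joins `v` and `u`. -/
theorem Joins.symm {e : E} {u v : V} (h : Z.Joins e u v) : Z.Joins e v u := Or.symm h

/-- The adjacencies are symmetric. -/
theorem Adj.symm {cond : E → Bool → Prop} {σ : State E T₁ T₂} {u v : V} (h : Z.Adj cond σ u v) :
    Z.Adj cond σ v u := by
  obtain ⟨e, hj, hc⟩ := h
  exact ⟨e, hj.symm, hc⟩

/-- The adjacencies are symmetric (relation form). -/
theorem adj_symm (cond : E → Bool → Prop) (σ : State E T₁ T₂) :
    ∀ x y, Z.Adj cond σ x y → Z.Adj cond σ y x := fun _ _ h => h.symm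

/-- An edge joining a vertex of `X` to anything touches `X`. -/
theorem touches_of_joins_left {X : Set V} {e : E} {u v : V} (hj : Z.Joins e u v) (hu : u ∈ X) :
    Z.Touches X e := by
  rcases hj with ⟨h1, _⟩ | ⟨_, h2⟩
  · left
    rw [h1]
    exact hu
  · right
    rw [h2]
    exact hu

/-- An edge joining two vertices outside `X` does not touch `X`. -/
theorem not_touches_of_joins {X : Set V} {e : E} {u v : V} (hj : Z.Joins e u v) (hu : u ∉ X) (hv : v ∉ X) :
    ¬ Z.Touches X e := by
  rintro (h | h) <;> rcases hj with ⟨h1, h2⟩ | ⟨h1, h2⟩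
  · exact hu (h1 ▸ h)
  · exact hv (h1 ▸ h)
  · exact hv (h2 ▸ h)
  · exact hu (h2 ▸ h)

/-- Touching is monotone in the set. -/
theorem touches_mono {X Y : Set V} (hXY : X ⊆ Y) {e : E} (h : Z.Touches X e) : Z.Touches Y e := by
  rcases h with h | h
  · exact Or.inl (hXY h)
  · exact Or.inr (hXY h)

/-- The reach of a set is closed under the adjacency. -/
theorem reach_closed (R : V → V → Prop) (S : Set V) : ∀ u v, u ∈ reach R S → R u v → v ∈ reach R S :=
  fun _ _ hu h => reach_tail hu h

/-! ## The AGREEMENT principle -/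

/-- Two states agreeing on the edges touching `U` have the same adjacencies from a vertex of `U`. -/
theorem adj_iff_of_agree {cond : E → Bool → Prop} {σ σ' : State E T₁ T₂} {U : Set V}
    (hagree : ∀ e, Z.Touches U e → σ'.1 e = σ.1 e) {u v : V} (hu : u ∈ U) :
    Z.Adj cond σ' u v ↔ Z.Adj cond σ u v := by
  constructor <;> rintro ⟨e, hj, hc⟩ <;> refine ⟨e, hj, ?_⟩
  · rwa [hagree e (Z.touches_of_joins_left hj hu)] at hc
  · rwa [hagree e (Z.touches_of_joins_left hj hu)]

/-- Two states agreeing on the edges touching a closed set `U ⊇ S` have the same reach of `S`. -/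
theorem reach_eq_of_agree_closed {cond : E → Bool → Prop} {σ σ' : State E T₁ T₂} {U S : Set V}
    (hagree : ∀ e, Z.Touches U e → σ'.1 e = σ.1 e) (hS : S ⊆ U)
    (hU : ∀ u v, u ∈ U → Z.Adj cond σ u v → v ∈ U) :
    reach (Z.Adj cond σ') S = reach (Z.Adj cond σ) S := by
  have hU' : ∀ u v, u ∈ U → Z.Adj cond σ' u v → v ∈ U :=
    fun u v hu h => hU u v hu ((Z.adj_iff_of_agree hagree hu).1 h)
  apply Set.Subset.antisymm
  · rintro v ⟨s, hs, h⟩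
    induction h with
    | refl => exact mem_reach_of_mem hs
    | tail _ h ih => exact reach_tail ih ((Z.adj_iff_of_agree hagree (reach_subset_of_closed hS hU ih)).1 h)
  · rintro v ⟨s, hs, h⟩
    induction h with
    | refl => exact mem_reach_of_mem hs
    | tail _ h ih => exact reach_tail ih ((Z.adj_iff_of_agree hagree (reach_subset_of_closed hS hU' ih)).2 h)

/-- **AGREEMENT**: states agreeing on the edges touching a set containing the reach of `S` have the same reach of
`S`. -/
theorem reach_eq_of_agree {cond : E → Bool → Prop} {σ σ' : State E T₁ T₂} {X S : Set V}
    (hX : reach (Z.Adj cond σ) S ⊆ X) (hagree : ∀ e, Z.Touches X e → σ'.1 e = σ.1 e) :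
    reach (Z.Adj cond σ') S = reach (Z.Adj cond σ) S :=
  Z.reach_eq_of_agree_closed (fun e he => hagree e (Z.touches_mono hX he)) subset_reach
    (reach_closed (Z.Adj cond σ) S)

/-- A dual outside a set containing the reach of `S` preserves that reach. -/
theorem reach_dual_eq {cond : E → Bool → Prop} (X : Set V) (σ : State E T₁ T₂) {S : Set V}
    (hX : reach (Z.Adj cond σ) S ⊆ X) : reach (Z.Adj cond (Z.dual X σ)) S = reach (Z.Adj cond σ) S :=
  Z.reach_eq_of_agree hX fun _ he => Z.dual_fst_of_touches X σ he

/-- A complement outside a set containing the reach of `S` preserves that reach. -/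
theorem reach_flipOut_eq {cond : E → Bool → Prop} (X : Set V) (σ : State E T₁ T₂) {S : Set V}
    (hX : reach (Z.Adj cond σ) S ⊆ X) : reach (Z.Adj cond (Z.flipOut X σ)) S = reach (Z.Adj cond σ) S :=
  Z.reach_eq_of_agree hX fun _ he => Z.flipOut_fst_of_touches X σ he

/-- `P` is preserved by a dual outside a set containing it. -/
theorem P_dual_eq (Q X : Set V) (σ : State E T₁ T₂) (hX : Z.P Q σ ⊆ X) : Z.P Q (Z.dual X σ) = Z.P Q σ :=
  Z.reach_dual_eq X σ hX

/-- `P` is preserved by a complement outside a set containing it. -/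
theorem P_flipOut_eq (Q X : Set V) (σ : State E T₁ T₂) (hX : Z.P Q σ ⊆ X) :
    Z.P Q (Z.flipOut X σ) = Z.P Q σ :=
  Z.reach_flipOut_eq X σ hX

/-- `D` is preserved by a complement outside a set containing it (the marks are unchanged). -/
theorem D_flipOut_eq (X : Set V) (σ : State E T₁ T₂) (hX : Z.D σ ⊆ X) : Z.D (Z.flipOut X σ) = Z.D σ := by
  unfold D
  rw [Z.Bl_flipOut]
  exact Z.reach_flipOut_eq X σ hX

/-- `C` is preserved by a dual outside a set containing `C` and `P`. -/
theorem Cmix_dual_eq (Q A X : Set V) (σ : State E T₁ T₂) (hP : Z.P Q σ ⊆ X) (hC : Z.Cmix Q A σ ⊆ X) :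
    Z.Cmix Q A (Z.dual X σ) = Z.Cmix Q A σ := by
  unfold Cmix
  rw [Z.P_dual_eq Q X σ hP]
  exact Z.reach_dual_eq X σ hC

/-! ## The COMPLEMENT principle -/

/-- Between two vertices outside `X` the dual sees the complemented colours. -/
theorem adj_dual_iff_of_not_mem {cond : E → Bool → Prop} (X : Set V) (σ : State E T₁ T₂) {u v : V}
    (hu : u ∉ X) (hv : v ∉ X) : Z.Adj cond (Z.dual X σ) u v ↔ Z.Adj (fun e b => cond e (!b)) σ u v := by
  constructor <;> rintro ⟨e, hj, hc⟩ <;> refine ⟨e, hj, ?_⟩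
  · rwa [Z.dual_fst_of_not_touches X σ (Z.not_touches_of_joins hj hu hv)] at hc
  · rwa [Z.dual_fst_of_not_touches X σ (Z.not_touches_of_joins hj hu hv)]

/-- Between two vertices outside `X` the complement sees the complemented colours. -/
theorem adj_flipOut_iff_of_not_mem {cond : E → Bool → Prop} (X : Set V) (σ : State E T₁ T₂) {u v : V}
    (hu : u ∉ X) (hv : v ∉ X) : Z.Adj cond (Z.flipOut X σ) u v ↔ Z.Adj (fun e b => cond e (!b)) σ u v := by
  constructor <;> rintro ⟨e, hj, hc⟩ <;> refine ⟨e, hj, ?_⟩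
  · rwa [Z.flipOut_fst_of_not_touches X σ (Z.not_touches_of_joins hj hu hv)] at hc
  · rwa [Z.flipOut_fst_of_not_touches X σ (Z.not_touches_of_joins hj hu hv)]

/-- Adjacency through an edge whose complemented colour is red is blue adjacency. -/
theorem adj_not_red_iff (σ : State E T₁ T₂) (u v : V) :
    Z.Adj (fun _ b => (!b) = true) σ u v ↔ Z.BlueAdj σ u v := by
  constructor <;> rintro ⟨e, hj, hc⟩ <;> refine ⟨e, hj, ?_⟩ <;> cases h : σ.1 e
  · rfl
  · rw [h] at hc
    exact absurd hc (by decide)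
  · rfl
  · rw [h] at hc
    exact absurd hc (by decide)

/-- Adjacency through an edge whose complemented colour is blue is red adjacency. -/
theorem adj_not_blue_iff (σ : State E T₁ T₂) (u v : V) :
    Z.Adj (fun _ b => (!b) = false) σ u v ↔ Z.RedAdj σ u v := by
  constructor <;> rintro ⟨e, hj, hc⟩ <;> refine ⟨e, hj, ?_⟩ <;> cases h : σ.1 e
  · rw [h] at hc
    exact absurd hc (by decide)
  · rfl
  · rw [h] at hc
    exact absurd hc (by decide)
  · rfl

/-- Between two vertices outside `X` the red adjacency of the dual is the blue adjacency. -/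
theorem redAdj_dual_iff (X : Set V) (σ : State E T₁ T₂) {u v : V} (hu : u ∉ X) (hv : v ∉ X) :
    Z.RedAdj (Z.dual X σ) u v ↔ Z.BlueAdj σ u v := by
  unfold RedAdj
  rw [Z.adj_dual_iff_of_not_mem X σ hu hv]
  exact Z.adj_not_red_iff σ u v

/-- Between two vertices outside `X` the blue adjacency of the dual is the red adjacency. -/
theorem blueAdj_dual_iff (X : Set V) (σ : State E T₁ T₂) {u v : V} (hu : u ∉ X) (hv : v ∉ X) :
    Z.BlueAdj (Z.dual X σ) u v ↔ Z.RedAdj σ u v := by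
  unfold BlueAdj
  rw [Z.adj_dual_iff_of_not_mem X σ hu hv]
  exact Z.adj_not_blue_iff σ u v

/-- Between two vertices outside `X` the red adjacency of the complement is the blue adjacency. -/
theorem redAdj_flipOut_iff (X : Set V) (σ : State E T₁ T₂) {u v : V} (hu : u ∉ X) (hv : v ∉ X) :
    Z.RedAdj (Z.flipOut X σ) u v ↔ Z.BlueAdj σ u v := by
  unfold RedAdj
  rw [Z.adj_flipOut_iff_of_not_mem X σ hu hv]
  exact Z.adj_not_red_iff σ u v

/-- Between two vertices outside `X` the blue adjacency of the complement is the red adjacency. -/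
theorem blueAdj_flipOut_iff (X : Set V) (σ : State E T₁ T₂) {u v : V} (hu : u ∉ X) (hv : v ∉ X) :
    Z.BlueAdj (Z.flipOut X σ) u v ↔ Z.RedAdj σ u v := by
  unfold BlueAdj
  rw [Z.adj_flipOut_iff_of_not_mem X σ hu hv]
  exact Z.adj_not_blue_iff σ u v

/-- The mixed adjacency relative to `P` of the dual outside `P` is the red adjacency. -/
theorem mixedAdj_dual_iff (P : Set V) (σ : State E T₁ T₂) (u v : V) :
    Z.MixedAdj P (Z.dual P σ) u v ↔ Z.RedAdj σ u v := by
  constructor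
  · rintro ⟨e, hj, hc⟩
    refine ⟨e, hj, ?_⟩
    rcases hc with ⟨ht, hc⟩ | ⟨ht, hc⟩
    · rwa [Z.dual_fst_of_touches P σ ht] at hc
    · rw [Z.dual_fst_of_not_touches P σ ht] at hc
      cases h : σ.1 e
      · rw [h] at hc
        exact absurd hc (by decide)
      · rfl
  · rintro ⟨e, hj, hc⟩
    refine ⟨e, hj, ?_⟩
    by_cases ht : Z.Touches P e
    · left
      rw [Z.dual_fst_of_touches P σ ht]
      exact ⟨ht, hc⟩
    · right
      rw [Z.dual_fst_of_not_touches P σ ht, hc]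
      exact ⟨ht, rfl⟩

/-! ## Blue-closed sets and `P ∩ D = ∅` -/

/-- A blue edge not touching `P` is a mixed adjacency. -/
theorem mixedAdj_of_blueAdj_of_not_touches {P : Set V} {σ : State E T₁ T₂} {u v : V}
    (h : Z.BlueAdj σ u v) (hu : u ∉ P) (hv : v ∉ P) : Z.MixedAdj P σ u v := by
  obtain ⟨e, hj, hc⟩ := h
  exact ⟨e, hj, Or.inr ⟨Z.not_touches_of_joins hj hu hv, hc⟩⟩

/-- A red edge touching `P` is a mixed adjacency. -/
theorem mixedAdj_of_redAdj_of_touches {P : Set V} {σ : State E T₁ T₂} {u v : V}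
    (h : Z.RedAdj σ u v) {e : E} (hj : Z.Joins e u v) (hc : σ.1 e = true) (ht : Z.Touches P e) :
    Z.MixedAdj P σ u v := by
  obtain ⟨_, _, _⟩ := h
  exact ⟨e, hj, Or.inl ⟨ht, hc⟩⟩

/-- The blue reach of a set is blue-closed. -/
theorem blue_closed_P (Q : Set V) (σ : State E T₁ T₂) : ∀ u v, u ∈ Z.P Q σ → Z.BlueAdj σ u v → v ∈ Z.P Q σ :=
  reach_closed _ _

/-- The deleted set is blue-closed. -/
theorem blue_closed_D (σ : State E T₁ T₂) : ∀ u v, u ∈ Z.D σ → Z.BlueAdj σ u v → v ∈ Z.D σ :=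
  reach_closed _ _

/-- A blue path from a vertex of `P` stays in `P`; so does a blue path from a vertex of `D` in `D`. -/
theorem not_mem_P_of_blueAdj (Q : Set V) (σ : State E T₁ T₂) {u v : V} (hu : u ∉ Z.P Q σ)
    (h : Z.BlueAdj σ u v) : v ∉ Z.P Q σ :=
  not_mem_of_adj_of_closed (Z.adj_symm _ σ) (Z.blue_closed_P Q σ) hu h

/-- A blue edge from outside `D` ends outside `D`. -/
theorem not_mem_D_of_blueAdj (σ : State E T₁ T₂) {u v : V} (hu : u ∉ Z.D σ) (h : Z.BlueAdj σ u v) :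
    v ∉ Z.D σ :=
  not_mem_of_adj_of_closed (Z.adj_symm _ σ) (Z.blue_closed_D σ) hu h

/-- Under `Γ` the protected sub-zones carry no blocker, hence no deleted vertex: `P ∩ D = ∅`. -/
theorem disjoint_P_D (Q : Set V) (σ : State E T₁ T₂) (hΓ : Z.Gam Q σ) : Disjoint (Z.P Q σ) (Z.D σ) := by
  rw [Set.disjoint_left]
  intro v hvP hvD
  obtain ⟨w, hw, hwv⟩ := exists_mem_reach_of_mem_reach (Z.adj_symm _ σ) hvD
  have hwP : w ∈ Z.P Q σ := by
    obtain ⟨_, hv', hvw⟩ := hwv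
    rw [Set.mem_singleton_iff] at hv'
    subst hv'
    exact reach_trans hvP hvw
  exact Set.disjoint_left.1 hΓ hwP (Or.inl hw)

end ZoneData

end ZoneZ

end PercRepro
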